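import Summits.PneNP.PneNP.Theorems.ChebyshevTracialDesignTiltedSmallBlockClassSplit
import Literature.Combinatorics.Optimization.ShellLawHalfPinning
import HarnessLib

/-!
# Cell pnp-psdrank, route `ChebyshevTracialDesign`: TILTED TWO SMALL BLOCKS — the class split with AVERAGED classes and the
# colour-type-constant containment form on a class pattern (brick 159a; crux `TracialDecayExp20`, stmt-PneNP-19878)

Brick 159a (prover g31; MEMO-34 §3). Brick 152a (`…TiltedSmallBlockClassSplit`) splits the shell average of a cut function `F` along a
`π`-stable class `K ⊆ S` under the hypothesis that `F(A ∪ B)` depends on `A ⊆ K` only through the pattern `(|A|, |half A|)`. For TWO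
blocks `H₁, H₂` and `K = V(AA(H₁ ∪ H₂))` (edges inside `H₁ ∪ H₂`: types `11`, `22`, `12`) this fails — the traces `|A ∩ H_i|` and the
containment form `Σ_{p∈full A} v_p` vary inside a pattern. The remedy is to AVERAGE each class instead of assuming it constant:

* §1 `sum_shellIn_eq_sum_pattern_sum`, **`shellAvg_eq_sum_classWeight_mul_avg₂'`**, **`shellAvg_eq_sum_classWeight_mul_avg₂`** — for ANY
  cut function `F`: `E_{Shell_S(2s+c,c)}[F] = Σ_{f≤a} Σ_{g≤a−f} W_{fg}(s,c)·(Σ_{A∈Shell_K(2f+g,g)} Σ_B F(A∪B))/(|Shell_K(2f+g,g)|·|Shell_{S∖K}(…)|)`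
  with the SAME multivariate-hypergeometric class weights `W_{fg} = C(a,f)C(a−f,g)(s)_f(c)_g(N−s−c)_{a−f−g}/(N)_a` (T-K4b's class-weight
  polynomials at the level `c`); the inner quantity is the average over the class representatives `A` of the `B`-averages.
* §2 **`containment_union_pattern₂`** — for disjoint `H₁, H₂`, `A ⊆ K`, `B ⊆ [n]∖K` and a direction `v` constant (`u₁`, `u₂`, `u₀`) on the
  `(H₁,out)`, `(H₂,out)`, `(out,out)` edges: `|(A∪B)∩H_i| = |A∩H_i| + |B∩H_i|` and
  `Σ_p v_p x_p x_{πp}(A∪B) = Σ_{p∈full A} v_p + 2(u₁−u₀)(X₁(B)−Y₁(B)) + 2(u₂−u₀)(X₂(B)−Y₂(B)) + u₀(|B|−|half B|)` — on the reduced ground set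
  the form is the two-block crossing-plane form of brick 158 with `λ_i = u_i − u₀`, `κ = u₀` (after `|B| − |half B| = t − |A| − c + |half A|`).
WHAT THIS FILE DOES NOT DO: any pricing (brick 159); anything on `TracialDecayExp20` itself, psd rank of P_PM(K_n), or P vs NP.
[cite: Rothvoss2017, §2 (PDF pp. 5–6)] [cite: ChattamvelliShanmugam2020, §7.4 (PDF p. 144), multivariate hypergeometric law]
[cite: GodsilMeagher2015, §15.2]
Stature: support/instrument (kernel lane, no defs, axioms standard). Supports stmt-PneNP-19878.
-/

set_option linter.dupNamespace false -- `Summit.PneNP.PneNP.…`: summit = sub-problem (D-0017)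

noncomputable section

namespace Summit.PneNP.PneNP.Theorems.ChebyshevTracialDesignTwoBlockClassSplit

open Finset Literature.Barriers.PneNP Literature.Combinatorics.Optimization
open Literature.Combinatorics.Optimization.ShellStep
open Summit.PneNP.PneNP.Theorems.ChebyshevTracialDesignTiltedSmallBlockClassSplit (class_bookkeeping)

variable {n : ℕ}

/-! ### §1 The class split of a shell average of an ARBITRARY cut function: classes are averaged, not assumed constant -/

section Split

variable {π : Fin n → Fin n} (hπ : ∀ v, π (π v) = v) (hπ' : ∀ v, π v ≠ v)
include hπ hπ'

/-- **Class split of a shell sum, COUNT form, arbitrary cut function.** For `π`-stable `K ⊆ S`: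
`Σ_{U∈Shell_S(2s+c,c)} F(U) = Σ_{f≤s} Σ_{g≤c} Σ_{A∈Shell_K(2f+g,g)} Σ_{B∈Shell_{S∖K}(2(s−f)+(c−g), c−g)} F(A ∪ B)` (the class pattern of
`U` is `(f, g)` = (full, half) edges of `K` in `U`). [cite: Rothvoss2017, §2 (PDF p. 6)] [cite: GodsilMeagher2015, §15.2] -/
theorem sum_shellIn_eq_sum_pattern_sum {S K : Finset (Fin n)} (hK : ∀ v ∈ K, π v ∈ K) (hKS : K ⊆ S) (s c : ℕ)
    (F : Finset (Fin n) → ℝ) :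
    ∑ U ∈ shellIn π S (2 * s + c) c, F U =
      ∑ f ∈ range (s + 1), ∑ g ∈ range (c + 1),
        ∑ A ∈ shellIn π K (2 * f + g) g, ∑ B ∈ shellIn π (S \ K) (2 * (s - f) + (c - g)) (c - g), F (A ∪ B) := by
  classical
  rw [← sum_fiberwise_of_maps_to (s := shellIn π S (2 * s + c) c)
    (t := range (s + 1) ×ˢ range (c + 1))
    (g := fun U => ((reps π (full π U ∩ K)).card, (half π U ∩ K).card)) (fun U hU => by
      obtain ⟨hUS, hUt, hUc⟩ := mem_shellIn.1 hU
      simp only [mem_product, mem_range, Nat.lt_succ_iff]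
      have hfull : ∀ v ∈ full π U, π v ∈ full π U := fun v hv => by
        obtain ⟨hvU, hπvU⟩ := mem_full.1 hv
        exact mem_full.2 ⟨hπvU, by rw [hπ]; exact hvU⟩
      have h2 := two_mul_card_reps hπ hπ' hfull
      have h3 := card_full_add_card_half (π := π) U
      have h4 : (reps π (full π U ∩ K)).card ≤ (reps π (full π U)).card :=
        card_le_card (fun v hv => by
          rw [mem_reps] at hv ⊢
          exact ⟨(mem_inter.1 hv.1).1, hv.2⟩)
      have h5 : (half π U ∩ K).card ≤ (half π U).card := card_le_card inter_subset_left
      constructor <;> omega),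
    sum_product]
  refine sum_congr rfl fun f hf => sum_congr rfl fun g hg => ?_
  have hg' : g ≤ c := Nat.lt_succ_iff.1 (mem_range.1 hg)
  have e : ((shellIn π S (2 * s + c) c).filter fun U =>
      ((reps π (full π U ∩ K)).card, (half π U ∩ K).card) = (f, g)) =
      (shellIn π S (2 * s + c) c).filter fun U => (U ∩ K).card = 2 * f + g ∧ (half π U ∩ K).card = g := by
    refine filter_congr fun U _ => ?_
    have hcl := card_inter_class_eq hπ hπ' (U := U) hK
    simp only [Prod.mk.injEq]
    constructor
    · rintro ⟨h1, h2⟩; exact ⟨by omega, h2⟩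
    · rintro ⟨h1, h2⟩; exact ⟨by omega, h2⟩
  have hf' : f ≤ s := Nat.lt_succ_iff.1 (mem_range.1 hf)
  rw [e, sum_shellIn_filter_class_eq hπ hK hKS (by omega) hg' F]
  have e1 : 2 * s + c - (2 * f + g) = 2 * (s - f) + (c - g) := by omega
  rw [e1]

/-- **Class split of a shell AVERAGE of an arbitrary cut function** (classes AVERAGED): for `π`-stable `S` with `N` edges,
`π`-stable `K ⊆ S` with `a` edges, `s + c ≤ N`:
`E_{Shell_S(2s+c,c)}[F] = Σ_{f≤s} Σ_{g≤c} W_{fg}(s,c) · (Σ_{A∈Shell_K(2f+g,g)} Σ_B F(A∪B)) / (|Shell_K(2f+g,g)|·|Shell_{S∖K}(2(s−f)+(c−g),c−g)|)`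
with the multivariate-hypergeometric class weights `W_{fg} = C(a,f)C(a−f,g)(s)_f(c)_g(N−s−c)_{a−f−g}/(N)_a` (brick 152a's
`shellAvg_eq_sum_classWeight_mul_avg'` is the case of a class-constant `F`). [cite: Rothvoss2017, §2 (PDF p. 6)]
[cite: ChattamvelliShanmugam2020, §7.4 (PDF p. 144), multivariate hypergeometric law] -/
theorem shellAvg_eq_sum_classWeight_mul_avg₂' {S K : Finset (Fin n)} (hS : ∀ v ∈ S, π v ∈ S) {N : ℕ} (hN : S.card = 2 * N)
    (hK : ∀ v ∈ K, π v ∈ K) (hKS : K ⊆ S) {a : ℕ} (ha : (reps π K).card = a) (s c : ℕ) (hsc : s + c ≤ N)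
    (F : Finset (Fin n) → ℝ) :
    (∑ U ∈ shellIn π S (2 * s + c) c, F U) / ((shellIn π S (2 * s + c) c).card : ℝ) =
      ∑ f ∈ range (s + 1), ∑ g ∈ range (c + 1),
        ((a.choose f : ℝ) * ((a - f).choose g : ℝ) * (s.descFactorial f : ℝ) * (c.descFactorial g : ℝ) *
            ((N - s - c).descFactorial (a - f - g) : ℝ) / (N.descFactorial a : ℝ)) *
          ((∑ A ∈ shellIn π K (2 * f + g) g, ∑ B ∈ shellIn π (S \ K) (2 * (s - f) + (c - g)) (c - g), F (A ∪ B)) /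
            (((shellIn π K (2 * f + g) g).card : ℝ) * ((shellIn π (S \ K) (2 * (s - f) + (c - g)) (c - g)).card : ℝ))) := by
  classical
  have hKcard : K.card = 2 * a := by rw [← ha, two_mul_card_reps hπ hπ' hK]
  have haN : a ≤ N := by have := card_le_card hKS; omega
  have hT : ∀ v ∈ S \ K, π v ∈ S \ K := by
    intro v hv
    rw [mem_sdiff] at hv ⊢
    exact ⟨hS v hv.1, fun h => hv.2 (by have := hK _ h; rwa [hπ] at this)⟩
  have hTcard : (S \ K).card = 2 * (N - a) := by
    rw [card_sdiff_of_subset hKS, hN, hKcard]; omega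
  rw [sum_shellIn_eq_sum_pattern_sum hπ hπ' hK hKS s c F, card_shellIn_eq_choose hπ hπ' hS hN s c, sum_div]
  refine sum_congr rfl fun f hf => ?_
  rw [sum_div]
  refine sum_congr rfl fun g hg => ?_
  have hf' : f ≤ s := Nat.lt_succ_iff.1 (mem_range.1 hf)
  have hg' : g ≤ c := Nat.lt_succ_iff.1 (mem_range.1 hg)
  rw [card_shellIn_eq_choose hπ hπ' hT hTcard (s - f) (c - g), card_shellIn_eq_choose hπ hπ' hK hKcard f g]
  set L := ∑ A ∈ shellIn π K (2 * f + g) g, ∑ B ∈ shellIn π (S \ K) (2 * (s - f) + (c - g)) (c - g), F (A ∪ B) with hL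
  have hD : ((N.choose s * (N - s).choose c * 2 ^ c : ℕ) : ℝ) ≠ 0 := by
    have h1 : 0 < N.choose s := Nat.choose_pos (by omega)
    have h2 : 0 < (N - s).choose c := Nat.choose_pos (by omega)
    positivity
  have hFa : (N.descFactorial a : ℝ) ≠ 0 := by
    have := Nat.descFactorial_pos.2 haN
    exact_mod_cast this.ne'
  by_cases hfg : f + g ≤ a
  · have hb := class_bookkeeping N a s c f g haN hf' hg' hsc hfg
    have hb' := congrArg (fun m : ℕ => (m : ℝ)) hb
    by_cases hE : (((a.choose f * (a - f).choose g * 2 ^ g : ℕ) : ℝ) *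
        (((N - a).choose (s - f) * ((N - a) - (s - f)).choose (c - g) * 2 ^ (c - g) : ℕ) : ℝ)) = 0
    · -- an empty class: both sides vanish
      have hempty : shellIn π K (2 * f + g) g = ∅ ∨ shellIn π (S \ K) (2 * (s - f) + (c - g)) (c - g) = ∅ := by
        rcases mul_eq_zero.1 hE with h | h
        · left; rw [← card_eq_zero, card_shellIn_eq_choose hπ hπ' hK hKcard f g]; exact_mod_cast h
        · right; rw [← card_eq_zero, card_shellIn_eq_choose hπ hπ' hT hTcard (s - f) (c - g)]; exact_mod_cast h
      have hL0 : L = 0 := by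
        rw [hL]
        rcases hempty with h | h
        · rw [h, sum_empty]
        · exact sum_eq_zero fun A _ => by rw [h, sum_empty]
      rw [hL0, zero_div, zero_div, mul_zero]
    · rw [div_mul_div_comm, div_eq_div_iff hD (mul_ne_zero hFa hE)]
      push_cast at hb' hE ⊢
      have h2g : (2 : ℝ) ^ g ≠ 0 := pow_ne_zero _ two_ne_zero
      -- `hb'`: `C(N−a,s−f)·C(…,c−g)·2^{c−g}·2^g·(N)_a = C(N,s)C(N−s,c)2^c·(s)_f(c)_g(N−s−c)_{a−f−g}`
      linear_combination ((a.choose f : ℝ) * ((a - f).choose g : ℝ) * L) * hb'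
  · -- an impossible class: `Shell_K(2f+g, g)` is empty
    push Not at hfg
    have hK0 : (a.choose f * (a - f).choose g * 2 ^ g : ℕ) = 0 := by
      rcases le_or_gt f a with h1 | h1
      · rw [Nat.choose_eq_zero_of_lt (n := a - f) (by omega)]; simp
      · rw [Nat.choose_eq_zero_of_lt h1]; simp
    have hempty : shellIn π K (2 * f + g) g = ∅ := by
      rw [← card_eq_zero, card_shellIn_eq_choose hπ hπ' hK hKcard f g, hK0]
    have hL0 : L = 0 := by rw [hL, hempty, sum_empty]
    rw [hL0, zero_div, zero_div, mul_zero]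

omit hπ hπ' in
/-- Extending the range of a sum whose summand vanishes from `m` on. [folklore] -/
theorem sum_range_eq_sum_range_of_vanish {T : ℕ → ℝ} {m K : ℕ} (hmK : m ≤ K)
    (h : ∀ i, m ≤ i → T i = 0) : ∑ i ∈ range m, T i = ∑ i ∈ range K, T i :=
  sum_subset (fun i hi => mem_range.2 (lt_of_lt_of_le (mem_range.1 hi) hmK)) fun i _ hni => h i (by
    simp only [mem_range, not_lt] at hni; exact hni)

/-- **Class split of a shell AVERAGE of an arbitrary cut function, ranges `f ≤ a`, `g ≤ a − f`** (at fixed cut size the weight of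
`(f, g)` is T-K4b's class-weight POLYNOMIAL of degree `a` in the level; terms with `f > s` or `g > c` vanish through `(s)_f`, `(c)_g`).
[cite: Rothvoss2017, §2 (PDF p. 6)] [cite: ChattamvelliShanmugam2020, §7.4 (PDF p. 144), multivariate hypergeometric law] -/
theorem shellAvg_eq_sum_classWeight_mul_avg₂ {S K : Finset (Fin n)} (hS : ∀ v ∈ S, π v ∈ S) {N : ℕ} (hN : S.card = 2 * N)
    (hK : ∀ v ∈ K, π v ∈ K) (hKS : K ⊆ S) {a : ℕ} (ha : (reps π K).card = a) (s c : ℕ) (hsc : s + c ≤ N)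
    (F : Finset (Fin n) → ℝ) :
    (∑ U ∈ shellIn π S (2 * s + c) c, F U) / ((shellIn π S (2 * s + c) c).card : ℝ) =
      ∑ f ∈ range (a + 1), ∑ g ∈ range (a - f + 1),
        ((a.choose f : ℝ) * ((a - f).choose g : ℝ) * (s.descFactorial f : ℝ) * (c.descFactorial g : ℝ) *
            ((N - s - c).descFactorial (a - f - g) : ℝ) / (N.descFactorial a : ℝ)) *
          ((∑ A ∈ shellIn π K (2 * f + g) g, ∑ B ∈ shellIn π (S \ K) (2 * (s - f) + (c - g)) (c - g), F (A ∪ B)) /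
            (((shellIn π K (2 * f + g) g).card : ℝ) * ((shellIn π (S \ K) (2 * (s - f) + (c - g)) (c - g)).card : ℝ))) := by
  rw [shellAvg_eq_sum_classWeight_mul_avg₂' hπ hπ' hS hN hK hKS ha s c hsc F]
  set T : ℕ → ℕ → ℝ := fun f g =>
    ((a.choose f : ℝ) * ((a - f).choose g : ℝ) * (s.descFactorial f : ℝ) * (c.descFactorial g : ℝ) *
        ((N - s - c).descFactorial (a - f - g) : ℝ) / (N.descFactorial a : ℝ)) *
      ((∑ A ∈ shellIn π K (2 * f + g) g, ∑ B ∈ shellIn π (S \ K) (2 * (s - f) + (c - g)) (c - g), F (A ∪ B)) /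
        (((shellIn π K (2 * f + g) g).card : ℝ) * ((shellIn π (S \ K) (2 * (s - f) + (c - g)) (c - g)).card : ℝ)))
    with hT
  have vf_s : ∀ f g, s < f → T f g = 0 := fun f g h => by
    simp only [hT, Nat.descFactorial_eq_zero_iff_lt.2 h, Nat.cast_zero, mul_zero, zero_mul, zero_div]
  have vg_c : ∀ f g, c < g → T f g = 0 := fun f g h => by
    simp only [hT, Nat.descFactorial_eq_zero_iff_lt.2 h, Nat.cast_zero, mul_zero, zero_mul, zero_div]
  have vf_a : ∀ f g, a < f → T f g = 0 := fun f g h => by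
    simp only [hT, Nat.choose_eq_zero_of_lt h, Nat.cast_zero, zero_mul, zero_div]
  have vg_a : ∀ f g, a - f < g → T f g = 0 := fun f g h => by
    simp only [hT, Nat.choose_eq_zero_of_lt h, Nat.cast_zero, mul_zero, zero_mul, zero_div]
  set K' := a + s + c + 1 with hK'
  show ∑ f ∈ range (s + 1), ∑ g ∈ range (c + 1), T f g = ∑ f ∈ range (a + 1), ∑ g ∈ range (a - f + 1), T f g
  have lhs : ∑ f ∈ range (s + 1), ∑ g ∈ range (c + 1), T f g = ∑ f ∈ range K', ∑ g ∈ range K', T f g := by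
    rw [sum_range_eq_sum_range_of_vanish (K := K') (by omega) (fun f hf => by
      exact sum_eq_zero fun g _ => vf_s f g (by omega))]
    exact sum_congr rfl fun f _ =>
      sum_range_eq_sum_range_of_vanish (K := K') (by omega) fun g hg => vg_c f g (by omega)
  have rhs : ∑ f ∈ range (a + 1), ∑ g ∈ range (a - f + 1), T f g = ∑ f ∈ range K', ∑ g ∈ range K', T f g := by
    rw [sum_range_eq_sum_range_of_vanish (K := K') (by omega) (fun f hf => by
      exact sum_eq_zero fun g _ => vf_a f g (by omega))]
    exact sum_congr rfl fun f _ =>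
      sum_range_eq_sum_range_of_vanish (K := K') (by omega) fun g hg => vg_a f g (by omega)
  rw [lhs, rhs]

end Split

/-! ### §2 The colour-type-constant containment form splits along the internal class of two blocks -/

section Pattern

variable {π : Fin n → Fin n} (hπ : ∀ v, π (π v) = v)
include hπ

/-- **The colour-type-constant containment form on a class pattern of two blocks.** `H₁, H₂` disjoint, `H = H₁ ∪ H₂`,
`K = V(AA(H))` (the vertices on matching edges INSIDE `H`), `A ⊆ K`, `B ⊆ [n] ∖ K`, and a direction `v` with `v_p = u₁` on the
`(H₁, out)` edges, `u₂` on the `(H₂, out)` edges, `u₀` on the `(out, out)` edges: then `|(A∪B) ∩ H_i| = |A ∩ H_i| + |B ∩ H_i|` and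
`Σ_p v_p x_p x_{πp}(A ∪ B) = Σ_{p ∈ full A} v_p + 2(u₁−u₀)(X₁(B)−Y₁(B)) + 2(u₂−u₀)(X₂(B)−Y₂(B)) + u₀(|B| − |half B|)`
(`X_i(B) = |B ∩ H_i|`, `Y_i(B) = |half B ∩ H_i|`). [cite: Rothvoss2017, §2 (PDF pp. 5–6)] -/
theorem containment_union_pattern₂ {H₁ H₂ : Finset (Fin n)} (hdisj : Disjoint H₁ H₂) (v : Fin n → ℝ) (u₁ u₂ u₀ : ℝ)
    (hv1 : ∀ p, (p ∈ H₁ ∧ π p ∉ H₁ ∪ H₂) ∨ (p ∉ H₁ ∪ H₂ ∧ π p ∈ H₁) → v p = u₁)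
    (hv2 : ∀ p, (p ∈ H₂ ∧ π p ∉ H₁ ∪ H₂) ∨ (p ∉ H₁ ∪ H₂ ∧ π p ∈ H₂) → v p = u₂)
    (hv0 : ∀ p, p ∉ H₁ ∪ H₂ → π p ∉ H₁ ∪ H₂ → v p = u₀) {A B : Finset (Fin n)} (hA : A ⊆ vAA π univ (H₁ ∪ H₂))
    (hB : B ⊆ univ \ vAA π univ (H₁ ∪ H₂)) :
    (((A ∪ B) ∩ H₁).card : ℤ) = ((A ∩ H₁).card : ℤ) + ((B ∩ H₁).card : ℤ) ∧
    (((A ∪ B) ∩ H₂).card : ℤ) = ((A ∩ H₂).card : ℤ) + ((B ∩ H₂).card : ℤ) ∧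
    ∑ p : Fin n, v p * ((if p ∈ A ∪ B then (1 : ℝ) else 0) * (if π p ∈ A ∪ B then (1 : ℝ) else 0)) =
      (∑ p ∈ full π A, v p) +
        (2 * (u₁ - u₀) * (((B ∩ H₁).card : ℝ) - ((half π B ∩ H₁).card : ℝ)) +
          2 * (u₂ - u₀) * (((B ∩ H₂).card : ℝ) - ((half π B ∩ H₂).card : ℝ)) +
          u₀ * ((B.card : ℝ) - ((half π B).card : ℝ))) := by
  classical
  set H := H₁ ∪ H₂ with hH
  have hK : ∀ p, p ∈ vAA π univ H ↔ p ∈ H ∧ π p ∈ H := fun p => by rw [mem_vAA]; simp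
  have hAK : ∀ p ∈ A, p ∈ H ∧ π p ∈ H := fun p hp => (hK p).1 (hA hp)
  have hBK : ∀ p ∈ B, ¬ (p ∈ H ∧ π p ∈ H) := fun p hp => fun h => (mem_sdiff.1 (hB hp)).2 ((hK p).2 h)
  have hdisjAB : Disjoint A B := disjoint_left.2 fun p hpA hpB => hBK p hpB (hAK p hpA)
  have hcnt : ∀ Hi : Finset (Fin n), (((A ∪ B) ∩ Hi).card : ℤ) = ((A ∩ Hi).card : ℤ) + ((B ∩ Hi).card : ℤ) := by
    intro Hi
    rw [union_inter_distrib_right, card_union_of_disjoint (disjoint_of_subset_left inter_subset_left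
      (disjoint_of_subset_right inter_subset_left hdisjAB))]
    push_cast; ring
  refine ⟨hcnt H₁, hcnt H₂, ?_⟩
  -- `x_p x_{πp}(A ∪ B) = [p ∈ full A] + [p ∈ full B]`
  have hx : ∀ p : Fin n, ((if p ∈ A ∪ B then (1 : ℝ) else 0) * (if π p ∈ A ∪ B then (1 : ℝ) else 0)) =
      (if p ∈ full π A then (1 : ℝ) else 0) + (if p ∈ full π B then (1 : ℝ) else 0) := by
    intro p
    by_cases hpA : p ∈ A
    · have hpK := hAK p hpA
      have hpB : p ∉ B := fun h => hBK p h hpK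
      have hπpB : π p ∉ B := fun h => hBK (π p) h ⟨hpK.2, by rw [hπ]; exact hpK.1⟩
      rw [if_pos (mem_union_left _ hpA), if_neg (fun h => hpB (mem_full.1 h).1)]
      by_cases hπpA : π p ∈ A
      · rw [if_pos (mem_union_left _ hπpA), if_pos (mem_full.2 ⟨hpA, hπpA⟩)]; ring
      · rw [if_neg (fun h => (mem_union.1 h).elim hπpA hπpB), if_neg (fun h => hπpA (mem_full.1 h).2)]; ring
    · rw [if_neg (fun h => hpA (mem_full.1 h).1)]
      by_cases hpB : p ∈ B
      · have hpK := hBK p hpB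
        have hπpA : π p ∉ A := fun h => hpK (by have := hAK _ h; rw [hπ] at this; exact ⟨this.2, this.1⟩)
        rw [if_pos (mem_union_right _ hpB)]
        by_cases hπpB : π p ∈ B
        · rw [if_pos (mem_union_right _ hπpB), if_pos (mem_full.2 ⟨hpB, hπpB⟩)]; ring
        · rw [if_neg (fun h => (mem_union.1 h).elim hπpA hπpB), if_neg (fun h => hπpB (mem_full.1 h).2)]; ring
      · rw [if_neg (fun h => (mem_union.1 h).elim hpA hpB), if_neg (fun h => hpB (mem_full.1 h).1)]; ring
  simp only [hx, mul_add, sum_add_distrib]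
  have hFA : ∑ p : Fin n, v p * (if p ∈ full π A then (1 : ℝ) else 0) = ∑ p ∈ full π A, v p := by
    simp only [mul_ite, mul_one, mul_zero]
    rw [← sum_filter, filter_mem_eq_inter, univ_inter]
  rw [hFA]
  congr 1
  -- on `B`: sort the full edges of `B` by the colour of their endpoints
  have hfullB : ∀ p ∈ full π B, ¬ (p ∈ H ∧ π p ∈ H) := fun p hp => hBK p (mem_full.1 hp).1
  have hvfull : ∀ p ∈ full π B, v p = u₀ + (u₁ - u₀) * ((if p ∈ H₁ then (1 : ℝ) else 0) + (if π p ∈ H₁ then (1 : ℝ) else 0))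
      + (u₂ - u₀) * ((if p ∈ H₂ then (1 : ℝ) else 0) + (if π p ∈ H₂ then (1 : ℝ) else 0)) := by
    intro p hp
    have hnot := hfullB p hp
    have d1 : ∀ q, q ∈ H₁ → q ∉ H₂ := fun q hq h => disjoint_left.1 hdisj hq h
    have d2 : ∀ q, q ∈ H₂ → q ∉ H₁ := fun q hq h => disjoint_left.1 hdisj h hq
    by_cases a1 : p ∈ H₁
    · have hpH : p ∈ H := mem_union_left _ a1
      have hπH : π p ∉ H := fun h => hnot ⟨hpH, h⟩
      rw [hv1 p (Or.inl ⟨a1, hπH⟩), if_pos a1, if_neg (d1 p a1), if_neg (fun h => hπH (mem_union_left _ h)),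
        if_neg (fun h => hπH (mem_union_right _ h))]; ring
    by_cases a2 : p ∈ H₂
    · have hpH : p ∈ H := mem_union_right _ a2
      have hπH : π p ∉ H := fun h => hnot ⟨hpH, h⟩
      rw [hv2 p (Or.inl ⟨a2, hπH⟩), if_neg a1, if_pos a2, if_neg (fun h => hπH (mem_union_left _ h)),
        if_neg (fun h => hπH (mem_union_right _ h))]; ring
    have hpH : p ∉ H := fun h => (mem_union.1 h).elim a1 a2
    by_cases b1 : π p ∈ H₁
    · rw [hv1 p (Or.inr ⟨hpH, b1⟩), if_neg a1, if_neg a2, if_pos b1, if_neg (d1 _ b1)]; ring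
    by_cases b2 : π p ∈ H₂
    · rw [hv2 p (Or.inr ⟨hpH, b2⟩), if_neg a1, if_neg a2, if_neg b1, if_pos b2]; ring
    rw [hv0 p hpH (fun h => (mem_union.1 h).elim b1 b2), if_neg a1, if_neg a2, if_neg b1, if_neg b2]; ring
  have hFB : ∑ p : Fin n, v p * (if p ∈ full π B then (1 : ℝ) else 0) = ∑ p ∈ full π B, v p := by
    simp only [mul_ite, mul_one, mul_zero]
    rw [← sum_filter, filter_mem_eq_inter, univ_inter]
  rw [hFB, sum_congr rfl hvfull]
  -- the colour counts over the full edges of `B`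
  have hstab : ∀ p ∈ full π B, π p ∈ full π B := fun p hp => by
    obtain ⟨h1, h2⟩ := mem_full.1 hp; exact mem_full.2 ⟨h2, by rw [hπ]; exact h1⟩
  have hcount : ∀ Hi : Finset (Fin n), ∑ p ∈ full π B, ((if p ∈ Hi then (1 : ℝ) else 0) + (if π p ∈ Hi then (1 : ℝ) else 0)) =
      2 * (((B ∩ Hi).card : ℝ) - ((half π B ∩ Hi).card : ℝ)) := by
    intro Hi
    have e1 : ∑ p ∈ full π B, (if p ∈ Hi then (1 : ℝ) else 0) = ((full π B ∩ Hi).card : ℝ) := by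
      rw [← sum_filter, filter_mem_eq_inter, sum_const]; simp
    have e2 : ∑ p ∈ full π B, (if π p ∈ Hi then (1 : ℝ) else 0) = ((full π B ∩ Hi).card : ℝ) := by
      rw [← e1]
      exact sum_nbij' (fun p => π p) (fun p => π p) (fun p hp => hstab p hp) (fun p hp => hstab p hp)
        (fun p _ => hπ p) (fun p _ => hπ p) (fun p _ => rfl)
    have e3 : ((full π B ∩ Hi).card : ℝ) + ((half π B ∩ Hi).card : ℝ) = ((B ∩ Hi).card : ℝ) := by
      have h := card_full_inter_add_card_half_inter (π := π) B Hi
      exact_mod_cast h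
    rw [sum_add_distrib, e1, e2]; linarith
  have hcard : ((full π B).card : ℝ) = (B.card : ℝ) - ((half π B).card : ℝ) := by
    have h := card_full_add_card_half (π := π) B
    have : ((full π B).card : ℝ) + ((half π B).card : ℝ) = (B.card : ℝ) := by exact_mod_cast h
    linarith
  rw [sum_add_distrib, sum_add_distrib, sum_const, nsmul_eq_mul, ← mul_sum, ← mul_sum, hcount H₁, hcount H₂, hcard]
  ring

end Pattern

end Summit.PneNP.PneNP.Theorems.ChebyshevTracialDesignTwoBlockClassSplit

end
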